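import Summits.QuantumFields.YangMills.Theorems.BalabanUVNodesN18AvgPotentialLogChartExp
import Summits.QuantumFields.YangMills.Theorems.BalabanUVNodesN18CombGaugeLetters

/-!
# BalabanUVNodes ∕ node N18 = NE5 — closure-ledger item (iii), (β3) proper AT THE CHART LEVEL: THE COMB GAUGE OF [Balaban1985Averaging] (62)–(63)∕(93) CONJUGATED INTO THE
# (0.4) AVERAGE OF RECORD — the DOUBLE-BAR potential `ξ′Ā(c) := (1∕i)·log(g(c₋)⁻¹·Ū(c)·g(c₊))`, `g = exp(iξ·λ̄_A)`, IS `ξ′·(QA)(c)` UP TO SECOND ORDER, in sup (C⁰,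
# `2000·ℓ²ξ²r²`), Lipschitz in the fine potential with the smallness factor (C¹, `3200·ℓ²ξ²r·ρ`) and in coarse unit differences (`3200·ℓ²ξ²r·(L·r₁)`); hence the
# GAUGE-CLEAN (1.12) letters `|Ā| ≤ |A|_feed + O(ℓ²ξr²∕L)`, `|∇^{ξ′}Ā| ≤ sup|∇^ξA|·(1 + 3200(d+2)²·L·ξr)` and `Ū(c) = g(c₋)·exp(iξ′Ā(c))·g(c₊)⁻¹`
# (Track A, DAG node N18 = `T4OutputRate.NE5` :211; cluster K4 «SpineRates», item K3⁷ `SpineGivenEndpointR13SepCoPH`; WIDTH SEAT pub-ymgap-dag-n18-w3 g2, file 3b)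

HONEST FRAMING.  Count-neutral kernel bookkeeping (`--supports stmt-QuantumFields-20544 --as helper`); elementary, PROVED by assembling file 2 (`…N18AvgPotentialLogChartExp`:
the single-bar letters in `A`) with the exp-free conjugation letters of file 3a `…N18CombGaugeLetters` (`YMDAG.N18.LogConjugation`) at `X = exp(−iξλ̄_A(c₋))`, `W = Ū(c)`, `Z = exp(iξλ̄_A(c₊))`
(logarithms of the gauge factors exact by `B7BlockAvgLog.mlog_exp`), the translation covariance of the comb means (`combMean_translate`, from dag-n18-d 26's
`walkSum_translate`), and King's K-row (dag-n18-d 19a).  The comb gauge is the tree's `Prop7CombGauge`∕`Prop8ChartOneStep` object `exp λ̄` read in the chart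
(`λ̄_Y ↦ iξλ̄_A`); its C⁰ one-step form for the unguarded complexified average is `Prop8Chart.norm_conj_emlAvgU_sub_one_le(_combMean)` (cited; different carrier).
NE5 is NOT PRINTED and NOT proved; N18 is NOT discharged; the transport clause `hT₀`∕`hTsp` is NOT discharged here.

WHY.  [Balaban1987RG1] (1.12) asks, on each `O(1)LM`-cube, for SOME gauge in which `U = exp iξA` with `|A|, |∇^ξA|` small; transporting it through one (0.4) step
needs a COARSE gauge that removes the comb term of the linearised average (`Q₁ = L·Q − dλ̄`, the `dλ̄` carrying no `∇A`-control) — print's `v` of (62)–(63), (93)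
`V̿₁ = v₋V̄₁v₊⁻¹`.  Files 1–2 kept the comb term linearised on the left side (single bar); this file performs the actual conjugation by the group elements
`g(y) = exp(iξλ̄_A(y))` (for Hermitian traceless `A_b` — `SU(N)` — the comb means are Hermitian traceless, so `g` is `SU(N)`-valued; not needed for the estimates and
not asserted here) and shows that nothing is lost: the double-bar potential has the SAME main term `ξ′·QA` and second-order remainders with the same structure
(sizes `t = ℓξr`: gauge factors `2t`, average `14t`; conjugation remainder `1300t²`, Lipschitz `2000·t·u`).  So at the chart level the (1.12) letters pass through
one averaging step with King's constants `× (1 + O(d²L·ξ·α₀))` — the spec's (β2)–(β5) programme, (β3) included.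

WHAT (`U_b = exp((iξ)·A_b)`, `‖A_b‖ ≤ r`, `0 ≤ ξ`, `48ℓξr ≤ 1`, `4ℓξr < δ_N`; `V(c) := exp(−iξλ̄_A(c₋))·Ū(c)·exp(iξλ̄_A(c₊))`).
* ★ `mlog_combConj_sub_eq` (`log V(c) − iξ′·QA(c) = P̃_c(A) + T_c(A)`), ★ `norm_mlog_combConj_sub_le` (C⁰ `2000·ℓ²ξ²r²`), ★ `norm_mlog_combConj_rem_sub_le` (C¹ `3200·ℓ²ξ²r·ρ`).
* ★ `norm_mlog_combConj_rem_shift_sub_le` (coarse unit differences `3200·ℓ²ξ²r·(L·r₁)`).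
* ★ `norm_mlog_combConj_le` (SUP letter), ★ `norm_shift_sub_mlog_combConj_le` (COARSE-DIFFERENCE letter), `exp_mlog_combConj` (`V = exp(log V)`: `Ū` is a comb-gauge
  transform of `exp(iξ′Ā)`).

WHAT THIS IS NOT.  Not LOCAL (two-block ∕ cube) hypotheses — the letters are stated with global sup bounds `r`, `r₁` (the local editions need the two-block read sets of
`Prop8ChartLocality`-type; successor); not the `Sect2.CondI`∕`cubesI` packaging at the tables of record; not the `SU(N)`-valuedness of `g`; not (T1)∕(T2) nor the
orbit-form (T3) knit through dag-n18-d 21 v1.1 (⇒ `hT₀`∕`hTsp`); finite tori at fixed `ε` — not continuum ∕ OS ∕ mass gap ∕ Clay.  0 `def`, 0 `sorry`, standard axioms.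
-/

open scoped BigOperators

namespace YMDAG.N18.AvgPotential

open Literature.MathematicalPhysics.QuantumFieldTheory.Balaban1983to89
open Literature.MathematicalPhysics.QuantumFieldTheory.Balaban1983to89.MatrixLog (mlog)
open YMDAG.N18.LogConjugation (norm_mlog_mul_mul_sub_le norm_mlog_mul_mul_rem_sub_le norm_mul_mul_sub_one_le)

/-! ## §1 The comb gauge of [Balaban1985Averaging] (62) conjugated into the (0.4) average of record: the double-bar potential (C⁰, C¹) -/

section DoubleBar

open NormedSpace (exp)
open Literature.MathematicalPhysics.QuantumFieldTheory.Balaban1983to89.T4Continuum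
open Literature.MathematicalPhysics.QuantumFieldTheory.Balaban1983to89.BlockAveraging
open Literature.MathematicalPhysics.QuantumFieldTheory.Balaban1983to89.LatticeFieldCalculus (bondAvg runBond runSite)
open Literature.MathematicalPhysics.QuantumFieldTheory.Balaban1983to89.ExpMeanLog (deltaSU expMeanLogSU)
open Literature.MathematicalPhysics.QuantumFieldTheory.Balaban1983to89.BlockAveragingEMLLinearised (walkSum linAvg combMean combMean_def)
open Literature.MathematicalPhysics.QuantumFieldTheory.Balaban1983to89.B7BlockAvgLog (mlog_exp)
open Literature.MathematicalPhysics.QuantumFieldTheory.Balaban1983to89.MatrixLog (exp_mlog)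
open YMDAG.N18.HolonomyLipschitz (avgFun_translate_apply)
open YMDAG.N18.CondIKRow (norm_bondAvg_le_of_forall_run norm_bondAvg_shift_sub_le_of_forall_run)
open Summit.QuantumFields.YangMills.Theorems.Prop7LinAvgOnto (norm_combMean_le)

open scoped Matrix.Norms.L2Operator

variable {n : Type*} [Fintype n] [DecidableEq n] [Nonempty n] {P : Params} {j : ℕ}

/-- `scale e_ν = L • e_ν` one level down (public twin `B13AvgCorrKappaOneLetters.scale_zero_shift` in the T⁴ `Support` tree, not imported; kept private). [folklore] -/
private theorem scale_unit_shift (ν : Fin P.d) : Site.scale ((0 : Site P (j + 1)).shift ν) = P.L • (0 : Site P j).shift ν := by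
  funext κ
  show Site.scaleCoord P j (((0 : Site P (j + 1)).shift ν) κ) = P.L • (((0 : Site P j).shift ν) κ)
  by_cases h : κ = ν
  · have h1 : ((0 : Site P (j + 1)).shift ν) κ = 1 := by rw [Site.shift_apply, if_pos h, Site.zero_apply, zero_add]
    have h2 : ((0 : Site P j).shift ν) κ = 1 := by rw [Site.shift_apply, if_pos h, Site.zero_apply, zero_add]
    rw [h1, h2, Site.scaleCoord_one, nsmul_eq_mul, mul_one]
  · have h1 : ((0 : Site P (j + 1)).shift ν) κ = 0 := by rw [Site.shift_apply, if_neg h, Site.zero_apply]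
    have h2 : ((0 : Site P j).shift ν) κ = 0 := by rw [Site.shift_apply, if_neg h, Site.zero_apply]
    rw [h1, h2, map_zero, smul_zero]

omit [Fintype n] [DecidableEq n] [Nonempty n] in
/-- Translating a bond by the unit vector `e_ν` shifts its source (`Site.add_zero_shift`). [folklore] -/
private theorem translate_unit_shift {i : ℕ} (b : PBond P i) (ν : Fin P.d) : b.translate ((0 : Site P i).shift ν) = ⟨b.src.shift ν, b.dir⟩ := by
  cases b; simp only [PBond.translate, Site.add_zero_shift]

/-- ★ **THE DOUBLE-BAR POTENTIAL, MAIN TERM IDENTIFIED**: with the comb gauge `g = exp(iξ·λ̄_A)` of [Balaban1985Averaging] (62) conjugated in,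
`V(c) := exp(−iξλ̄_A(c₋))·Ū(c)·exp(iξλ̄_A(c₊))` satisfies `log V(c) = i(Lξ)·(QA)(c) + [P̃_c(A) + T_c(A)]` — file 2's single-bar identity plus §1's exp-free conjugation
remainder `T_c = log(XWZ) − (log X + log W + log Z)`, the logarithms of the two gauge factors being `∓iξλ̄_A` exactly (`B7BlockAvgLog.mlog_exp`, `‖iξλ̄_A‖ ≤ ℓξr < log 2`).
[cite: Balaban1985Averaging, (62)-(63) p.28, (93) p.32 and Prop. 3 (121)-(125) p.36] -/
theorem mlog_combConj_sub_eq (U : GaugeField P j (Matrix.specialUnitaryGroup n ℂ)) (A : PBond P j → Matrix n n ℂ) {ξ r : ℝ} (hξ : 0 ≤ ξ) (hr : 0 ≤ r)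
    (hA : ∀ b, ‖A b‖ ≤ r) (h48 : 48 * ((((P.d + 2) * P.L : ℕ) : ℝ) * (ξ * r)) ≤ 1) (c : PBond P (j + 1)) :
    mlog (exp ((Complex.I * ξ : ℂ) • (-combMean A c.src)) * (((avgFun (expMeanLogSU (n := n)) U c : Matrix.specialUnitaryGroup n ℂ) : Matrix n n ℂ)) *
        exp ((Complex.I * ξ : ℂ) • combMean A c.tgt)) - (Complex.I * ξ * P.L : ℂ) • bondAvg A c =
      (mlog (((avgFun (expMeanLogSU (n := n)) U c : Matrix.specialUnitaryGroup n ℂ) : Matrix n n ℂ)) - (Complex.I * ξ : ℂ) • linAvg A c) +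
        (mlog (exp ((Complex.I * ξ : ℂ) • (-combMean A c.src)) * (((avgFun (expMeanLogSU (n := n)) U c : Matrix.specialUnitaryGroup n ℂ) : Matrix n n ℂ)) *
              exp ((Complex.I * ξ : ℂ) • combMean A c.tgt)) -
          (mlog (exp ((Complex.I * ξ : ℂ) • (-combMean A c.src))) + mlog (((avgFun (expMeanLogSU (n := n)) U c : Matrix.specialUnitaryGroup n ℂ) : Matrix n n ℂ)) +
            mlog (exp ((Complex.I * ξ : ℂ) • combMean A c.tgt)))) := by
  -- the logarithms of the two gauge factors
  have hℓr : ξ * ((((P.d + 2) * P.L : ℕ) : ℝ) * r) < Real.log 2 := by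
    have h2 : (1 : ℝ) / 48 < Real.log 2 := by have := Real.log_two_gt_d9; linarith
    nlinarith [mul_nonneg hξ (mul_nonneg (Nat.cast_nonneg ((P.d + 2) * P.L)) hr)]
  have hsrc : mlog (exp ((Complex.I * ξ : ℂ) • (-combMean A c.src))) = (Complex.I * ξ : ℂ) • (-combMean A c.src) := by
    refine mlog_exp (lt_of_le_of_lt ?_ hℓr)
    rw [smul_neg, norm_neg]; exact norm_smul_combMean_le A hξ hr hA c.src
  have htgt : mlog (exp ((Complex.I * ξ : ℂ) • combMean A c.tgt)) = (Complex.I * ξ : ℂ) • combMean A c.tgt :=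
    mlog_exp (lt_of_le_of_lt (norm_smul_combMean_le A hξ hr hA c.tgt) hℓr)
  have hid := mlog_avgFun_add_smul_grad_combMean_eq U A ξ c
  rw [hsrc, htgt]
  rw [smul_sub] at hid
  rw [smul_neg]
  -- linear algebra over the identity `hid`
  have e : ∀ (lV lW q p cs ct : Matrix n n ℂ), lW + (ct - cs) = q + p → lV - q = p + (lV - (-cs + lW + ct)) := by
    intro lV lW q p cs ct h
    have h' : p = lW + (ct - cs) - q := by rw [h]; abel
    rw [h']; abel
  exact e _ _ _ _ _ _ hid

/-- ★ **PROP. 3 (123) IN THE COMB GAUGE (DOUBLE BAR), C⁰**: for `U_b = exp(iξA_b)`, `‖A_b‖ ≤ r`, `48ℓξr ≤ 1`, `4ℓξr < δ_N` (`ℓ = (d+2)L`):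
`‖log V(c) − i(Lξ)·(QA)(c)‖ ≤ 2000·ℓ²ξ²r²` — after the coarse gauge transformation by the comb means the potential of the averaged field IS `ξ′ = Lξ` times the
straight block average of the fine potential up to second order (file 2's `607ℓ²ξ²r²` + §1's `1300(ℓξr)²`; print's (93) `V̿₁ = v₋V̄₁v₊⁻¹` and (123)).
[cite: Balaban1985Averaging, (62)-(63) p.28, (93) p.32, Prop. 3 (121)-(123) p.36; Balaban1987RG1, (1.12) p.262] -/
theorem norm_mlog_combConj_sub_le (U : GaugeField P j (Matrix.specialUnitaryGroup n ℂ)) (A : PBond P j → Matrix n n ℂ) {ξ r : ℝ} (hξ : 0 ≤ ξ) (hr : 0 ≤ r)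
    (hUA : ∀ b, ((U b : Matrix.specialUnitaryGroup n ℂ) : Matrix n n ℂ) = exp ((Complex.I * ξ : ℂ) • A b)) (hA : ∀ b, ‖A b‖ ≤ r)
    (h48 : 48 * ((((P.d + 2) * P.L : ℕ) : ℝ) * (ξ * r)) ≤ 1) (hN : 4 * ((((P.d + 2) * P.L : ℕ) : ℝ) * (ξ * r)) < deltaSU n) (c : PBond P (j + 1)) :
    ‖mlog (exp ((Complex.I * ξ : ℂ) • (-combMean A c.src)) * (((avgFun (expMeanLogSU (n := n)) U c : Matrix.specialUnitaryGroup n ℂ) : Matrix n n ℂ)) *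
          exp ((Complex.I * ξ : ℂ) • combMean A c.tgt)) - (Complex.I * ξ * P.L : ℂ) • bondAvg A c‖ ≤
      2000 * (((P.d + 2) * P.L : ℕ) : ℝ) ^ 2 * ξ ^ 2 * r ^ 2 := by
  set ℓ : ℝ := (((P.d + 2) * P.L : ℕ) : ℝ) with hℓ
  set t : ℝ := ℓ * (ξ * r) with ht
  have hℓ0 : 0 ≤ ℓ := Nat.cast_nonneg _
  have ht0 : 0 ≤ t := mul_nonneg hℓ0 (mul_nonneg hξ hr)
  have ht48 : 48 * t ≤ 1 := h48
  have hξr1 : ξ * (ℓ * r) ≤ 1 := by nlinarith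
  -- the three factors in the ball
  have hX : ‖exp ((Complex.I * ξ : ℂ) • (-combMean A c.src)) - 1‖ ≤ 2 * t := by
    have h := norm_expI_smul_sub_one_le (n := n) hξ (X := -combMean A c.src) (r := ℓ * r) (by rw [norm_neg]; exact norm_combMean_le A hr hA _) hξr1
    refine h.trans (le_of_eq ?_); rw [ht]; ring
  have hZ : ‖exp ((Complex.I * ξ : ℂ) • combMean A c.tgt) - 1‖ ≤ 2 * t := by
    have h := norm_expI_smul_sub_one_le (n := n) hξ (X := combMean A c.tgt) (r := ℓ * r) (norm_combMean_le A hr hA _) hξr1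
    refine h.trans (le_of_eq ?_); rw [ht]; ring
  have hξr1' : ξ * r ≤ 1 := by
    have hℓ1 : 1 ≤ ℓ := by rw [hℓ]; exact_mod_cast Nat.one_le_iff_ne_zero.mpr (Nat.mul_ne_zero (by omega) P.L_pos.ne')
    nlinarith [mul_nonneg hξ hr]
  have hU : ∀ b, ‖((U b : Matrix.specialUnitaryGroup n ℂ) : Matrix n n ℂ) - 1‖ ≤ 2 * (ξ * r) := fun b => by
    rw [hUA]; exact norm_expI_smul_sub_one_le hξ (hA b) hξr1'
  have h24 : 24 * (ℓ * (2 * (ξ * r))) ≤ 1 := by linarith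
  have hN' : 2 * (ℓ * (2 * (ξ * r))) < deltaSU n := by linarith
  have hW : ‖(((avgFun (expMeanLogSU (n := n)) U c : Matrix.specialUnitaryGroup n ℂ) : Matrix n n ℂ)) - 1‖ ≤ 14 * t := by
    have h := norm_avgFun_sub_one_le_lin U (by positivity) hU h24 hN' c
    refine h.trans (le_of_eq ?_); rw [ht]; ring
  have hT := norm_mlog_mul_mul_sub_le hX hW hZ ht48
  have hP := norm_potRemA_le U A hξ hr hUA hA h48 hN c
  rw [mlog_combConj_sub_eq U A hξ hr hA h48 c]
  calc _ ≤ _ := norm_add_le _ _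
    _ ≤ 607 * ℓ ^ 2 * ξ ^ 2 * r ^ 2 + 1300 * t ^ 2 := add_le_add hP hT
    _ = 1907 * ℓ ^ 2 * ξ ^ 2 * r ^ 2 := by rw [ht]; ring
    _ ≤ 2000 * ℓ ^ 2 * ξ ^ 2 * r ^ 2 := by nlinarith [sq_nonneg (ℓ * ξ * r)]

/-- ★ **PROP. 3 IN THE COMB GAUGE (DOUBLE BAR), C¹**: for `U_b = exp(iξA_b)`, `U′_b = exp(iξA′_b)`, `‖A_b‖, ‖A′_b‖ ≤ r`, `‖A_b − A′_b‖ ≤ ρ` (`48ℓξr ≤ 1`, `4ℓξr < δ_N`):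
the double-bar remainders `log V(c) − iξ′·(QA)(c)` of `A` and `A′` differ by at most `3200·ℓ²ξ²r·ρ` (file 2's `1166` + §1's `2000·t·u` at `t = ℓξr`, `u = ℓξρ`: the gauge
factors move by `≤ 2u`, the average by `≤ 22u`). [cite: Balaban1985Averaging, (62)-(63) p.28, Prop. 3 (121)-(123) p.36; Balaban1987RG1, (1.12) p.262] -/
theorem norm_mlog_combConj_rem_sub_le (U U' : GaugeField P j (Matrix.specialUnitaryGroup n ℂ)) (A A' : PBond P j → Matrix n n ℂ) {ξ r ρ : ℝ} (hξ : 0 ≤ ξ)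
    (hr : 0 ≤ r) (hρ : 0 ≤ ρ)
    (hUA : ∀ b, ((U b : Matrix.specialUnitaryGroup n ℂ) : Matrix n n ℂ) = exp ((Complex.I * ξ : ℂ) • A b))
    (hUA' : ∀ b, ((U' b : Matrix.specialUnitaryGroup n ℂ) : Matrix n n ℂ) = exp ((Complex.I * ξ : ℂ) • A' b))
    (hA : ∀ b, ‖A b‖ ≤ r) (hA' : ∀ b, ‖A' b‖ ≤ r) (hAA' : ∀ b, ‖A b - A' b‖ ≤ ρ)
    (h48 : 48 * ((((P.d + 2) * P.L : ℕ) : ℝ) * (ξ * r)) ≤ 1) (hN : 4 * ((((P.d + 2) * P.L : ℕ) : ℝ) * (ξ * r)) < deltaSU n) (c : PBond P (j + 1)) :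
    ‖(mlog (exp ((Complex.I * ξ : ℂ) • (-combMean A c.src)) * (((avgFun (expMeanLogSU (n := n)) U c : Matrix.specialUnitaryGroup n ℂ) : Matrix n n ℂ)) *
            exp ((Complex.I * ξ : ℂ) • combMean A c.tgt)) - (Complex.I * ξ * P.L : ℂ) • bondAvg A c) -
        (mlog (exp ((Complex.I * ξ : ℂ) • (-combMean A' c.src)) * (((avgFun (expMeanLogSU (n := n)) U' c : Matrix.specialUnitaryGroup n ℂ) : Matrix n n ℂ)) *
            exp ((Complex.I * ξ : ℂ) • combMean A' c.tgt)) - (Complex.I * ξ * P.L : ℂ) • bondAvg A' c)‖ ≤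
      3200 * (((P.d + 2) * P.L : ℕ) : ℝ) ^ 2 * ξ ^ 2 * r * ρ := by
  set ℓ : ℝ := (((P.d + 2) * P.L : ℕ) : ℝ) with hℓ
  set t : ℝ := ℓ * (ξ * r) with ht
  set u : ℝ := ℓ * (ξ * ρ) with hu
  have hℓ0 : 0 ≤ ℓ := Nat.cast_nonneg _
  have hℓ1 : 1 ≤ ℓ := by rw [hℓ]; exact_mod_cast Nat.one_le_iff_ne_zero.mpr (Nat.mul_ne_zero (by omega) P.L_pos.ne')
  have ht0 : 0 ≤ t := mul_nonneg hℓ0 (mul_nonneg hξ hr)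
  have hu0 : 0 ≤ u := mul_nonneg hℓ0 (mul_nonneg hξ hρ)
  have ht48 : 48 * t ≤ 1 := h48
  have hξr1 : ξ * (ℓ * r) ≤ 1 := by nlinarith
  have hξr2 : 2 * (ξ * (ℓ * r)) ≤ 1 := by nlinarith
  have hξr1' : ξ * r ≤ 1 := by nlinarith [mul_nonneg hξ hr]
  have hξr2' : 2 * (ξ * r) ≤ 1 := by nlinarith [mul_nonneg hξ hr]
  -- comb means: sizes and differences
  have hcm : ∀ (B : PBond P j → Matrix n n ℂ), (∀ b, ‖B b‖ ≤ r) → ∀ y, ‖combMean B y‖ ≤ ℓ * r := fun B hB y => norm_combMean_le B hr hB y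
  have hcmn : ∀ (B : PBond P j → Matrix n n ℂ), (∀ b, ‖B b‖ ≤ r) → ∀ y, ‖-combMean B y‖ ≤ ℓ * r := fun B hB y => by rw [norm_neg]; exact hcm B hB y
  have hcd : ∀ y, ‖combMean A y - combMean A' y‖ ≤ ℓ * ρ := fun y => by
    rw [← combMean_sub']; exact norm_combMean_le _ hρ hAA' y
  -- the three factors of each triple in the ball
  have hX : ‖exp ((Complex.I * ξ : ℂ) • (-combMean A c.src)) - 1‖ ≤ 2 * t :=
    (norm_expI_smul_sub_one_le (n := n) hξ (hcmn A hA _) hξr1).trans (le_of_eq (by rw [ht]; ring))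
  have hX' : ‖exp ((Complex.I * ξ : ℂ) • (-combMean A' c.src)) - 1‖ ≤ 2 * t :=
    (norm_expI_smul_sub_one_le (n := n) hξ (hcmn A' hA' _) hξr1).trans (le_of_eq (by rw [ht]; ring))
  have hZ : ‖exp ((Complex.I * ξ : ℂ) • combMean A c.tgt) - 1‖ ≤ 2 * t :=
    (norm_expI_smul_sub_one_le (n := n) hξ (hcm A hA _) hξr1).trans (le_of_eq (by rw [ht]; ring))
  have hZ' : ‖exp ((Complex.I * ξ : ℂ) • combMean A' c.tgt) - 1‖ ≤ 2 * t :=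
    (norm_expI_smul_sub_one_le (n := n) hξ (hcm A' hA' _) hξr1).trans (le_of_eq (by rw [ht]; ring))
  have hU : ∀ b, ‖((U b : Matrix.specialUnitaryGroup n ℂ) : Matrix n n ℂ) - 1‖ ≤ 2 * (ξ * r) := fun b => by
    rw [hUA]; exact norm_expI_smul_sub_one_le hξ (hA b) hξr1'
  have hU' : ∀ b, ‖((U' b : Matrix.specialUnitaryGroup n ℂ) : Matrix n n ℂ) - 1‖ ≤ 2 * (ξ * r) := fun b => by
    rw [hUA']; exact norm_expI_smul_sub_one_le hξ (hA' b) hξr1'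
  have hUU' : ∀ b, ‖((U b : Matrix.specialUnitaryGroup n ℂ) : Matrix n n ℂ) - ((U' b : Matrix.specialUnitaryGroup n ℂ) : Matrix n n ℂ)‖ ≤ 2 * ξ * ρ :=
    fun b => by
      rw [hUA, hUA']
      exact (norm_expI_smul_sub_expI_smul_le hξ (hA b) (hA' b) hξr2').trans (mul_le_mul_of_nonneg_left (hAA' b) (by positivity))
  have h24 : 24 * (ℓ * (2 * (ξ * r))) ≤ 1 := by linarith
  have hN' : 2 * (ℓ * (2 * (ξ * r))) < deltaSU n := by linarith
  have hW : ‖(((avgFun (expMeanLogSU (n := n)) U c : Matrix.specialUnitaryGroup n ℂ) : Matrix n n ℂ)) - 1‖ ≤ 14 * t :=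
    (norm_avgFun_sub_one_le_lin U (by positivity) hU h24 hN' c).trans (le_of_eq (by rw [ht]; ring))
  have hW' : ‖(((avgFun (expMeanLogSU (n := n)) U' c : Matrix.specialUnitaryGroup n ℂ) : Matrix n n ℂ)) - 1‖ ≤ 14 * t :=
    (norm_avgFun_sub_one_le_lin U' (by positivity) hU' h24 hN' c).trans (le_of_eq (by rw [ht]; ring))
  -- the differences of the factors
  have hXX' : ‖exp ((Complex.I * ξ : ℂ) • (-combMean A c.src)) - exp ((Complex.I * ξ : ℂ) • (-combMean A' c.src))‖ ≤ 2 * u := by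
    refine (norm_expI_smul_sub_expI_smul_le hξ (hcmn A hA _) (hcmn A' hA' _) hξr2).trans ?_
    rw [neg_sub_neg, norm_sub_rev]
    calc 2 * ξ * ‖combMean A c.src - combMean A' c.src‖ ≤ 2 * ξ * (ℓ * ρ) := mul_le_mul_of_nonneg_left (hcd _) (by positivity)
      _ = 2 * u := by rw [hu]; ring
  have hZZ' : ‖exp ((Complex.I * ξ : ℂ) • combMean A c.tgt) - exp ((Complex.I * ξ : ℂ) • combMean A' c.tgt)‖ ≤ 2 * u := by
    refine (norm_expI_smul_sub_expI_smul_le hξ (hcm A hA _) (hcm A' hA' _) hξr2).trans ?_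
    calc 2 * ξ * ‖combMean A c.tgt - combMean A' c.tgt‖ ≤ 2 * ξ * (ℓ * ρ) := mul_le_mul_of_nonneg_left (hcd _) (by positivity)
      _ = 2 * u := by rw [hu]; ring
  have hWW' : ‖(((avgFun (expMeanLogSU (n := n)) U c : Matrix.specialUnitaryGroup n ℂ) : Matrix n n ℂ)) -
      (((avgFun (expMeanLogSU (n := n)) U' c : Matrix.specialUnitaryGroup n ℂ) : Matrix n n ℂ))‖ ≤ 22 * u := by
    refine (norm_avgFun_sub_avgFun_le U U' (by positivity) (by positivity) hU hU' hUU' h24 hN' c).trans ?_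
    have e1 : (3 + 181 * (ℓ * (2 * (ξ * r)))) * (ℓ * (2 * ξ * ρ)) = (6 + 724 * t) * u := by rw [ht, hu]; ring
    rw [e1]
    have : (6 + 724 * t) ≤ 22 := by linarith
    exact mul_le_mul_of_nonneg_right this hu0
  -- assembly
  have hT := norm_mlog_mul_mul_rem_sub_le hu0 hX hW hZ hX' hW' hZ' ht48 hXX' hWW' hZZ'
  have hP := norm_potRemA_sub_potRemA_le U U' A A' hξ hr hρ hUA hUA' hA hA' hAA' h48 hN c
  rw [mlog_combConj_sub_eq U A hξ hr hA h48 c, mlog_combConj_sub_eq U' A' hξ hr hA' h48 c]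
  have e : ∀ (p q p' q' : Matrix n n ℂ), (p + q) - (p' + q') = (p - p') + (q - q') := fun _ _ _ _ => by abel
  rw [e]
  calc _ ≤ _ := norm_add_le _ _
    _ ≤ 1166 * ℓ ^ 2 * ξ ^ 2 * r * ρ + 2000 * t * u := add_le_add hP hT
    _ = 3166 * ℓ ^ 2 * ξ ^ 2 * r * ρ := by rw [ht, hu]; ring
    _ ≤ 3200 * ℓ ^ 2 * ξ ^ 2 * r * ρ := by
        have : 0 ≤ ℓ ^ 2 * ξ ^ 2 * r * ρ := by positivity
        nlinarith

/-! ## §2 Coarse unit differences and the gauge-clean (1.12) letters of the double-bar potential -/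

/-- ★ **COARSE UNIT DIFFERENCES OF THE DOUBLE-BAR REMAINDER ARE SECOND ORDER**: for `U_b = exp(iξA_b)`, `‖A_b‖ ≤ r`, unit `ν`-differences `‖A(b + e_ν) − A(b)‖ ≤ r₁`
(`48ℓξr ≤ 1`, `4ℓξr < δ_N`), `c = ⟨y, μ⟩`, `c′ = ⟨y + e_ν, μ⟩`: the remainders `log V − iξ′·QA` at `c′` and `c` differ by at most `3200·ℓ²ξ²r·(L·r₁)` — §2b's C¹ bound at the
translated pair (`combMean_translate_shift`, `avgFun_translate`, file 2's `linAvg_translate_shift` road). [cite: Balaban1987RG1, (1.12) p.262 and (2.17) p.269; Balaban1985Averaging, Prop. 3 (123) p.36] -/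
theorem norm_mlog_combConj_rem_shift_sub_le (U : GaugeField P j (Matrix.specialUnitaryGroup n ℂ)) (A : PBond P j → Matrix n n ℂ) (y : Site P (j + 1))
    (μ ν : Fin P.d) {ξ r r₁ : ℝ} (hξ : 0 ≤ ξ) (hr : 0 ≤ r) (hr₁ : 0 ≤ r₁)
    (hUA : ∀ b, ((U b : Matrix.specialUnitaryGroup n ℂ) : Matrix n n ℂ) = exp ((Complex.I * ξ : ℂ) • A b)) (hA : ∀ b, ‖A b‖ ≤ r)
    (hA₁ : ∀ b : PBond P j, ‖A ⟨b.src.shift ν, b.dir⟩ - A b‖ ≤ r₁)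
    (h48 : 48 * ((((P.d + 2) * P.L : ℕ) : ℝ) * (ξ * r)) ≤ 1) (hN : 4 * ((((P.d + 2) * P.L : ℕ) : ℝ) * (ξ * r)) < deltaSU n) :
    ‖(mlog (exp ((Complex.I * ξ : ℂ) • (-combMean A (y.shift ν))) *
              (((avgFun (expMeanLogSU (n := n)) U ⟨y.shift ν, μ⟩ : Matrix.specialUnitaryGroup n ℂ) : Matrix n n ℂ)) *
            exp ((Complex.I * ξ : ℂ) • combMean A ((y.shift ν).shift μ))) - (Complex.I * ξ * P.L : ℂ) • bondAvg A ⟨y.shift ν, μ⟩) -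
        (mlog (exp ((Complex.I * ξ : ℂ) • (-combMean A y)) * (((avgFun (expMeanLogSU (n := n)) U ⟨y, μ⟩ : Matrix.specialUnitaryGroup n ℂ) : Matrix n n ℂ)) *
            exp ((Complex.I * ξ : ℂ) • combMean A (y.shift μ))) - (Complex.I * ξ * P.L : ℂ) • bondAvg A ⟨y, μ⟩)‖ ≤
      3200 * (((P.d + 2) * P.L : ℕ) : ℝ) ^ 2 * ξ ^ 2 * r * (P.L * r₁) := by
  -- the translated pair
  set a : Site P j := P.L • (0 : Site P j).shift ν with ha
  set U' : GaugeField P j (Matrix.specialUnitaryGroup n ℂ) := U.translate a with hU'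
  set A' : PBond P j → Matrix n n ℂ := fun b => A (b.translate a) with hA'
  have hUA' : ∀ b, ((U' b : Matrix.specialUnitaryGroup n ℂ) : Matrix n n ℂ) = exp ((Complex.I * ξ : ℂ) • A' b) := fun b => by
    rw [hU', GaugeField.translate_apply, hUA]
  have hA'r : ∀ b, ‖A' b‖ ≤ r := fun b => hA _
  have htel : ∀ (m : ℕ) (b : PBond P j), ‖A (b.translate (m • (0 : Site P j).shift ν)) - A b‖ ≤ m * r₁ := by
    intro m
    induction m with
    | zero =>
      intro b
      have h0 : b.translate ((0 : ℕ) • (0 : Site P j).shift ν) = b := by cases b; simp [PBond.translate]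
      rw [h0, sub_self, norm_zero, Nat.cast_zero, zero_mul]
    | succ m ih =>
      intro b
      have hs : b.translate ((m + 1) • (0 : Site P j).shift ν) = (b.translate (m • (0 : Site P j).shift ν)).translate ((0 : Site P j).shift ν) := by
        rw [PBond.translate_translate, succ_nsmul]
      rw [hs]
      have h1 := hA₁ (b.translate (m • (0 : Site P j).shift ν))
      rw [← translate_unit_shift] at h1
      calc _ ≤ ‖A ((b.translate (m • (0 : Site P j).shift ν)).translate ((0 : Site P j).shift ν)) - A (b.translate (m • (0 : Site P j).shift ν))‖ +
              ‖A (b.translate (m • (0 : Site P j).shift ν)) - A b‖ := norm_sub_le_norm_sub_add_norm_sub _ _ _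
        _ ≤ r₁ + m * r₁ := add_le_add h1 (ih b)
        _ = ((m + 1 : ℕ) : ℝ) * r₁ := by push_cast; ring
  have hAA' : ∀ b, ‖A' b - A b‖ ≤ P.L * r₁ := fun b => by rw [hA']; exact htel P.L b
  -- every object at `c′` is the object of the translated pair at `c`
  have havg : (((avgFun (expMeanLogSU (n := n)) U ⟨y.shift ν, μ⟩ : Matrix.specialUnitaryGroup n ℂ) : Matrix n n ℂ)) =
      (((avgFun (expMeanLogSU (n := n)) U' ⟨y, μ⟩ : Matrix.specialUnitaryGroup n ℂ) : Matrix n n ℂ)) := by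
    have h := avgFun_translate_apply ((0 : Site P (j + 1)).shift ν) U (⟨y, μ⟩ : PBond P (j + 1))
    rw [translate_unit_shift, scale_unit_shift] at h
    rw [hU', ha, h]
  have hsrc : combMean A (y.shift ν) = combMean A' y := by rw [hA', ha, combMean_translate_shift]
  have htgt : combMean A ((y.shift ν).shift μ) = combMean A' (y.shift μ) := by rw [hA', ha, combMean_translate_shift, Site.shift_comm]
  have hQ : bondAvg A ⟨y.shift ν, μ⟩ = bondAvg A' ⟨y, μ⟩ := by
    -- the straight block average is translation-covariant too: read it off `Q₁ = L·Q − dλ̄` for both fields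
    have h1 := BlockAveragingEMLLinearised.linAvg_eq_bondAvg_sub_grad_combMean A (⟨y.shift ν, μ⟩ : PBond P (j + 1))
    have h2 := BlockAveragingEMLLinearised.linAvg_eq_bondAvg_sub_grad_combMean A' (⟨y, μ⟩ : PBond P (j + 1))
    have hl : linAvg A ⟨y.shift ν, μ⟩ = linAvg A' ⟨y, μ⟩ := by rw [hA', ha, linAvg_translate_shift]
    change linAvg A ⟨y.shift ν, μ⟩ = ((P.L : ℕ) : ℂ) • bondAvg A ⟨y.shift ν, μ⟩ - (combMean A ((y.shift ν).shift μ) - combMean A (y.shift ν)) at h1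
    change linAvg A' ⟨y, μ⟩ = ((P.L : ℕ) : ℂ) • bondAvg A' ⟨y, μ⟩ - (combMean A' (y.shift μ) - combMean A' y) at h2
    rw [hl, h2, ← hsrc, ← htgt] at h1
    have hL : ((P.L : ℕ) : ℂ) ≠ 0 := Nat.cast_ne_zero.mpr P.L_pos.ne'
    have h3 : ((P.L : ℕ) : ℂ) • bondAvg A' ⟨y, μ⟩ = ((P.L : ℕ) : ℂ) • bondAvg A ⟨y.shift ν, μ⟩ := sub_left_injective h1
    exact (smul_right_injective (Matrix n n ℂ) hL h3).symm
  rw [havg, hsrc, htgt, hQ]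
  exact norm_mlog_combConj_rem_sub_le U' U A' A hξ hr (mul_nonneg (Nat.cast_nonneg _) hr₁) hUA' hUA hA'r hA hAA' h48 hN ⟨y, μ⟩

/-! ## §3 The gauge-clean (1.12) letters of the double-bar potential `ξ′Ā := (1∕i)·log V` -/

/-- ★ **THE SUP LETTER OF THE DOUBLE-BAR POTENTIAL**: `U_b = exp(iξA_b)`, `‖A_b‖ ≤ r` everywhere and `≤ a` on the `L^{d+1}` FEEDING bonds of `c` (`48ℓξr ≤ 1`,
`4ℓξr < δ_N`): `‖log V(c)‖ ≤ (Lξ)·a + 2000·ℓ²ξ²r²`, i.e. for `Ā(c) := (iξ′)⁻¹ log V(c)`, `ξ′ = Lξ`: `|Ā(c)| ≤ |A|_feed + 2000(d+2)²·L·ξ·r²` — King's (K-a) (dag-n18-d 19a) plus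
the second order; print's `|Ā| < O(1)LMBα₀` from `|A| < O(1)LMBα₀` with a relative slack `O(ℓ²ξα₀)`. [cite: Balaban1987RG1, (1.12) p.262; Balaban1985Averaging, (93) p.32 and Prop. 3 (123) p.36] -/
theorem norm_mlog_combConj_le (U : GaugeField P j (Matrix.specialUnitaryGroup n ℂ)) (A : PBond P j → Matrix n n ℂ) (c : PBond P (j + 1)) {ξ r a : ℝ}
    (hξ : 0 ≤ ξ) (hr : 0 ≤ r)
    (hUA : ∀ b, ((U b : Matrix.specialUnitaryGroup n ℂ) : Matrix n n ℂ) = exp ((Complex.I * ξ : ℂ) • A b)) (hA : ∀ b, ‖A b‖ ≤ r)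
    (ha : ∀ ρ : Fin P.d → Fin P.L, ∀ t < P.L, ‖A (runBond (Site.blockSite c.src ρ) c.dir t)‖ ≤ a)
    (h48 : 48 * ((((P.d + 2) * P.L : ℕ) : ℝ) * (ξ * r)) ≤ 1) (hN : 4 * ((((P.d + 2) * P.L : ℕ) : ℝ) * (ξ * r)) < deltaSU n) :
    ‖mlog (exp ((Complex.I * ξ : ℂ) • (-combMean A c.src)) * (((avgFun (expMeanLogSU (n := n)) U c : Matrix.specialUnitaryGroup n ℂ) : Matrix n n ℂ)) *
        exp ((Complex.I * ξ : ℂ) • combMean A c.tgt))‖ ≤ P.L * ξ * a + 2000 * (((P.d + 2) * P.L : ℕ) : ℝ) ^ 2 * ξ ^ 2 * r ^ 2 := by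
  set lV := mlog (exp ((Complex.I * ξ : ℂ) • (-combMean A c.src)) * (((avgFun (expMeanLogSU (n := n)) U c : Matrix.specialUnitaryGroup n ℂ) : Matrix n n ℂ)) *
        exp ((Complex.I * ξ : ℂ) • combMean A c.tgt))
  have hQ : ‖bondAvg A c‖ ≤ a := norm_bondAvg_le_of_forall_run (V := Matrix n n ℂ) _ c ha
  have hP := norm_mlog_combConj_sub_le U A hξ hr hUA hA h48 hN c
  have e : lV = (Complex.I * ξ * P.L : ℂ) • bondAvg A c + (lV - (Complex.I * ξ * P.L : ℂ) • bondAvg A c) := by abel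
  rw [e]
  have hL : ‖(Complex.I * ξ * P.L : ℂ) • bondAvg A c‖ ≤ P.L * ξ * a := by
    rw [norm_smul, norm_mul, norm_mul, Complex.norm_I, one_mul, Complex.norm_real, Real.norm_of_nonneg hξ, Complex.norm_natCast]
    calc ξ * P.L * ‖bondAvg A c‖ ≤ ξ * P.L * a := mul_le_mul_of_nonneg_left hQ (by positivity)
      _ = P.L * ξ * a := by ring
  exact (norm_add_le _ _).trans (add_le_add hL hP)

/-- ★ **THE COARSE-DIFFERENCE LETTER OF THE DOUBLE-BAR POTENTIAL** (standing range `j + 1 ≤ m + K`): `U_b = exp(iξA_b)`, `‖A_b‖ ≤ r`, unit `ν`-differences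
`‖A(b + e_ν) − A(b)‖ ≤ r₁` (`48ℓξr ≤ 1`, `4ℓξr < δ_N`); for `c = ⟨y, μ⟩`, `c′ = ⟨y + e_ν, μ⟩`: `‖log V(c′) − log V(c)‖ ≤ (Lξ)·(L·r₁) + 3200·ℓ²ξ²r·(L·r₁)` — dividing by `ξ′ = Lξ`
and the coarse spacing: `|∇^{ξ′}_ν Ā| ≤ sup|∇^ξ_ν A|·(1 + 3200(d+2)²·L·ξr)` — King's EXACT (K-b) plus the relative slack `O(d²L·ξ·α₀)`, summable in the scale: print's transport
of `|∇^ξA| < O(1)LMBα₀` through one (0.4) averaging-and-comb-gauge step, AT THE CHART LEVEL. [cite: Balaban1987RG1, (1.12) p.262; Balaban1985Averaging, (62)-(63) p.28, (93) p.32, Prop. 3 (123) p.36] -/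
theorem norm_shift_sub_mlog_combConj_le (hj : j + 1 ≤ P.m + P.K) (U : GaugeField P j (Matrix.specialUnitaryGroup n ℂ)) (A : PBond P j → Matrix n n ℂ)
    (y : Site P (j + 1)) (μ ν : Fin P.d) {ξ r r₁ : ℝ} (hξ : 0 ≤ ξ) (hr : 0 ≤ r) (hr₁ : 0 ≤ r₁)
    (hUA : ∀ b, ((U b : Matrix.specialUnitaryGroup n ℂ) : Matrix n n ℂ) = exp ((Complex.I * ξ : ℂ) • A b)) (hA : ∀ b, ‖A b‖ ≤ r)
    (hA₁ : ∀ b : PBond P j, ‖A ⟨b.src.shift ν, b.dir⟩ - A b‖ ≤ r₁)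
    (h48 : 48 * ((((P.d + 2) * P.L : ℕ) : ℝ) * (ξ * r)) ≤ 1) (hN : 4 * ((((P.d + 2) * P.L : ℕ) : ℝ) * (ξ * r)) < deltaSU n) :
    ‖mlog (exp ((Complex.I * ξ : ℂ) • (-combMean A (y.shift ν))) *
            (((avgFun (expMeanLogSU (n := n)) U ⟨y.shift ν, μ⟩ : Matrix.specialUnitaryGroup n ℂ) : Matrix n n ℂ)) *
          exp ((Complex.I * ξ : ℂ) • combMean A ((y.shift ν).shift μ))) -
        mlog (exp ((Complex.I * ξ : ℂ) • (-combMean A y)) * (((avgFun (expMeanLogSU (n := n)) U ⟨y, μ⟩ : Matrix.specialUnitaryGroup n ℂ) : Matrix n n ℂ)) *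
          exp ((Complex.I * ξ : ℂ) • combMean A (y.shift μ)))‖ ≤
      P.L * ξ * (P.L * r₁) + 3200 * (((P.d + 2) * P.L : ℕ) : ℝ) ^ 2 * ξ ^ 2 * r * (P.L * r₁) := by
  set lV1 := mlog (exp ((Complex.I * ξ : ℂ) • (-combMean A (y.shift ν))) *
      (((avgFun (expMeanLogSU (n := n)) U ⟨y.shift ν, μ⟩ : Matrix.specialUnitaryGroup n ℂ) : Matrix n n ℂ)) * exp ((Complex.I * ξ : ℂ) • combMean A ((y.shift ν).shift μ)))
  set lV0 := mlog (exp ((Complex.I * ξ : ℂ) • (-combMean A y)) *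
      (((avgFun (expMeanLogSU (n := n)) U ⟨y, μ⟩ : Matrix.specialUnitaryGroup n ℂ) : Matrix n n ℂ)) * exp ((Complex.I * ξ : ℂ) • combMean A (y.shift μ)))
  have hKb : ‖bondAvg A ⟨y.shift ν, μ⟩ - bondAvg A ⟨y, μ⟩‖ ≤ P.L * r₁ :=
    norm_bondAvg_shift_sub_le_of_forall_run (V := Matrix n n ℂ) hj A y μ ν fun ρ t _ s _ => hA₁ ⟨runSite (runSite (Site.blockSite y ρ) μ t) ν s, μ⟩
  have hP := norm_mlog_combConj_rem_shift_sub_le U A y μ ν hξ hr hr₁ hUA hA hA₁ h48 hN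
  have e : lV1 - lV0 = (Complex.I * ξ * P.L : ℂ) • (bondAvg A ⟨y.shift ν, μ⟩ - bondAvg A ⟨y, μ⟩) +
      ((lV1 - (Complex.I * ξ * P.L : ℂ) • bondAvg A ⟨y.shift ν, μ⟩) - (lV0 - (Complex.I * ξ * P.L : ℂ) • bondAvg A ⟨y, μ⟩)) := by
    rw [smul_sub]; abel
  rw [e]
  have hL : ‖(Complex.I * ξ * P.L : ℂ) • (bondAvg A ⟨y.shift ν, μ⟩ - bondAvg A ⟨y, μ⟩)‖ ≤ P.L * ξ * (P.L * r₁) := by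
    rw [norm_smul, norm_mul, norm_mul, Complex.norm_I, one_mul, Complex.norm_real, Real.norm_of_nonneg hξ, Complex.norm_natCast]
    calc ξ * P.L * ‖bondAvg A ⟨y.shift ν, μ⟩ - bondAvg A ⟨y, μ⟩‖ ≤ ξ * P.L * (P.L * r₁) := mul_le_mul_of_nonneg_left hKb (by positivity)
      _ = P.L * ξ * (P.L * r₁) := by ring
  exact (norm_add_le _ _).trans (add_le_add hL hP)

/-- **THE AVERAGED FIELD IS A COMB-GAUGE TRANSFORM OF `exp(iξ′Ā)`** (the literal (1.12) form one level up): `V(c) = exp(log V(c))` on the ball (`‖V(c) − 1‖ ≤ 20ℓξr < 1`,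
`MatrixLog.exp_mlog`), i.e. `Ū(c) = exp(iξλ̄_A(c₋))·exp(iξ′Ā(c))·exp(−iξλ̄_A(c₊))` with `ξ′Ā(c) := (1∕i)·log V(c)` carrying the letters above.
[cite: Balaban1987RG1, (1.12) p.262; Balaban1985Averaging, (93) p.32] -/
theorem exp_mlog_combConj (U : GaugeField P j (Matrix.specialUnitaryGroup n ℂ)) (A : PBond P j → Matrix n n ℂ) {ξ r : ℝ} (hξ : 0 ≤ ξ) (hr : 0 ≤ r)
    (hUA : ∀ b, ((U b : Matrix.specialUnitaryGroup n ℂ) : Matrix n n ℂ) = exp ((Complex.I * ξ : ℂ) • A b)) (hA : ∀ b, ‖A b‖ ≤ r)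
    (h48 : 48 * ((((P.d + 2) * P.L : ℕ) : ℝ) * (ξ * r)) ≤ 1) (hN : 4 * ((((P.d + 2) * P.L : ℕ) : ℝ) * (ξ * r)) < deltaSU n) (c : PBond P (j + 1)) :
    exp (mlog (exp ((Complex.I * ξ : ℂ) • (-combMean A c.src)) * (((avgFun (expMeanLogSU (n := n)) U c : Matrix.specialUnitaryGroup n ℂ) : Matrix n n ℂ)) *
        exp ((Complex.I * ξ : ℂ) • combMean A c.tgt))) =
      exp ((Complex.I * ξ : ℂ) • (-combMean A c.src)) * (((avgFun (expMeanLogSU (n := n)) U c : Matrix.specialUnitaryGroup n ℂ) : Matrix n n ℂ)) *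
        exp ((Complex.I * ξ : ℂ) • combMean A c.tgt) := by
  set ℓ : ℝ := (((P.d + 2) * P.L : ℕ) : ℝ) with hℓ
  set t : ℝ := ℓ * (ξ * r) with ht
  have hℓ0 : 0 ≤ ℓ := Nat.cast_nonneg _
  have hℓ1 : 1 ≤ ℓ := by rw [hℓ]; exact_mod_cast Nat.one_le_iff_ne_zero.mpr (Nat.mul_ne_zero (by omega) P.L_pos.ne')
  have ht48 : 48 * t ≤ 1 := h48
  have hξr1 : ξ * (ℓ * r) ≤ 1 := by nlinarith [mul_nonneg hξ hr]
  have hξr1' : ξ * r ≤ 1 := by nlinarith [mul_nonneg hξ hr]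
  have hX : ‖exp ((Complex.I * ξ : ℂ) • (-combMean A c.src)) - 1‖ ≤ 2 * t :=
    (norm_expI_smul_sub_one_le (n := n) hξ (X := -combMean A c.src) (r := ℓ * r) (by rw [norm_neg]; exact norm_combMean_le A hr hA _) hξr1).trans
      (le_of_eq (by rw [ht]; ring))
  have hZ : ‖exp ((Complex.I * ξ : ℂ) • combMean A c.tgt) - 1‖ ≤ 2 * t :=
    (norm_expI_smul_sub_one_le (n := n) hξ (X := combMean A c.tgt) (r := ℓ * r) (norm_combMean_le A hr hA _) hξr1).trans (le_of_eq (by rw [ht]; ring))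
  have hU : ∀ b, ‖((U b : Matrix.specialUnitaryGroup n ℂ) : Matrix n n ℂ) - 1‖ ≤ 2 * (ξ * r) := fun b => by
    rw [hUA]; exact norm_expI_smul_sub_one_le hξ (hA b) hξr1'
  have h24 : 24 * (ℓ * (2 * (ξ * r))) ≤ 1 := by linarith
  have hN' : 2 * (ℓ * (2 * (ξ * r))) < deltaSU n := by linarith
  have hW : ‖(((avgFun (expMeanLogSU (n := n)) U c : Matrix.specialUnitaryGroup n ℂ) : Matrix n n ℂ)) - 1‖ ≤ 14 * t :=
    (norm_avgFun_sub_one_le_lin U (by positivity) hU h24 hN' c).trans (le_of_eq (by rw [ht]; ring))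
  have hV := norm_mul_mul_sub_one_le hX hW hZ ht48
  exact exp_mlog (lt_of_le_of_lt hV (by linarith))

end DoubleBar

end YMDAG.N18.AvgPotential
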